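import Summits.Parity.GeneralizedHardyLittlewood.Theorems.PrimeLevelFamEdgeMomentsBeyondDiagonalDiagDecorMult
import HarnessLib

/-!
# Route `PrimeLevelFamEdge`, crux K_A `MomentsBeyondDiagonal` (stmt-Parity-20007), line «petersson_layers» v4, stub `stub_diag`:
# **the divisor-log sums of total degree two: `τ_{α,β} = τ_{β,α}`, `τ_{2,0} + 2τ_{1,1} + τ_{0,2} = τ·log²`,
# and `τ_{2,0} = τ_{0,2} = τ(log²k + P₂)/4` on squarefree `k` (census R3(ii), analytic half)**

Continues `…DiagDecorMult` (`τ_{1,1} = τ(log²k − P₂(k))/4` on squarefree `k`): the decorations of the general-`Q` Selberg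
coordinates for `deg Q ≤ 2` need all `τ_{α,β}(k) = Σ_{d∣k}(log d)^α(log(k/d))^β` with `α, β ≤ 2`.

* `sum_divisors_log_pow_swap` — `τ_{α,β} = τ_{β,α}` (`d ↔ k/d`), every `k`;
* `sum_divisors_log_add_log_div_sq` — `Σ_{d∣k}(log d + log(k/d))² = τ(k)·log²k`, i.e. `τ_{2,0} + 2τ_{1,1} + τ_{0,2} = τ log²k`
  (`k ≥ 1`);
* `tau20_eq_of_squarefree` — **`Σ_{d∣k} log²d = τ(k)(log²k + Σ_{p∣k}log²p)/4` for squarefree `k`** (hence also `τ_{0,2}`).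

Def-free; theorems only. Helper `--supports stmt-Parity-20007`; closes nothing; K_A, K_B and the Parity summit are NOT
proved; nothing about Landau–Siegel zeros.

## References
* E. Kowalski, P. Michel, J. VanderKam, J. reine angew. Math. 526 (2000), (23)–(28) pp. 13–15.
  [cite: KowalskiMichelVanderKam2000, (23)–(28) — derivation (bookkeeping of log-decorations)]
-/

noncomputable section

open Finset

namespace Summit.Parity.GeneralizedHardyLittlewood.Theorems.MomentsBeyondDiagonal.DiagLines

/-- **`τ_{α,β}(k) = τ_{β,α}(k)`**: `Σ_{d∣k}(log d)^α(log(k/d))^β = Σ_{d∣k}(log d)^β(log(k/d))^α` (`d ↔ k/d`, `k ≥ 1`).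
[folklore] -/
theorem sum_divisors_log_pow_swap {k : ℕ} (hk : k ≠ 0) (α β : ℕ) :
    ∑ d ∈ k.divisors, Real.log d ^ α * Real.log ((k / d : ℕ) : ℝ) ^ β =
      ∑ d ∈ k.divisors, Real.log d ^ β * Real.log ((k / d : ℕ) : ℝ) ^ α := by
  rw [← Nat.sum_div_divisors k (fun d ↦ Real.log d ^ β * Real.log ((k / d : ℕ) : ℝ) ^ α)]
  refine Finset.sum_congr rfl fun d hd ↦ ?_
  have hd' := (Nat.mem_divisors.1 hd).1
  rw [Nat.div_div_self hd' hk, mul_comm]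

/-- **`Σ_{d∣k}(log d + log(k/d))² = τ(k)·log²k`** for `k ≥ 1` (`log d + log(k/d) = log k`). [folklore] -/
theorem sum_divisors_log_add_log_div_sq {k : ℕ} (hk : k ≠ 0) :
    ∑ d ∈ k.divisors, (Real.log d + Real.log ((k / d : ℕ) : ℝ)) ^ 2 = (k.divisors.card : ℝ) * Real.log k ^ 2 := by
  have h : ∀ d ∈ k.divisors, (Real.log d + Real.log ((k / d : ℕ) : ℝ)) ^ 2 = Real.log k ^ 2 := by
    intro d hd
    have hd' := (Nat.mem_divisors.1 hd).1
    have hd0 : d ≠ 0 := by rintro rfl; exact hk (zero_dvd_iff.1 hd')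
    have hkd0 : k / d ≠ 0 := (Nat.div_ne_zero_iff_of_dvd hd').2 ⟨hk, hd0⟩
    rw [← Real.log_mul (by exact_mod_cast hd0) (by exact_mod_cast hkd0)]
    congr 2
    exact_mod_cast Nat.mul_div_cancel' hd'
  rw [Finset.sum_congr rfl h, Finset.sum_const, nsmul_eq_mul]

/-- **`τ_{2,0}` on squarefree numbers**: `Σ_{d∣k} log²d = τ(k)·(log²k + Σ_{p∣k}log²p)/4` for squarefree `k`
(from `τ_{2,0} = τ_{0,2}`, `τ_{2,0} + 2τ_{1,1} + τ_{0,2} = τ log²k` and `τ_{1,1} = τ(log²k − P₂)/4`). [folklore] -/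
theorem tau20_eq_of_squarefree {k : ℕ} (hk : Squarefree k) :
    ∑ d ∈ k.divisors, Real.log d ^ 2 =
      (k.divisors.card : ℝ) * (Real.log k ^ 2 + ∑ p ∈ k.primeFactors, Real.log p ^ 2) / 4 := by
  have hk0 : k ≠ 0 := hk.ne_zero
  have h11 := tau11_eq_of_squarefree hk
  have hsq := sum_divisors_log_add_log_div_sq hk0
  -- `τ_{0,2} = τ_{2,0}`
  have hswap : ∑ d ∈ k.divisors, Real.log ((k / d : ℕ) : ℝ) ^ 2 = ∑ d ∈ k.divisors, Real.log d ^ 2 := by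
    have h := sum_divisors_log_pow_swap hk0 2 0
    simpa using h.symm
  -- expand the square inside the sum
  have hexp : ∑ d ∈ k.divisors, (Real.log d + Real.log ((k / d : ℕ) : ℝ)) ^ 2 =
      ∑ d ∈ k.divisors, Real.log d ^ 2 + 2 * ∑ d ∈ k.divisors, Real.log d * Real.log ((k / d : ℕ) : ℝ) +
        ∑ d ∈ k.divisors, Real.log ((k / d : ℕ) : ℝ) ^ 2 := by
    rw [Finset.mul_sum, ← Finset.sum_add_distrib, ← Finset.sum_add_distrib]
    exact Finset.sum_congr rfl fun d _ ↦ by ring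
  rw [hexp, hswap, h11] at hsq
  linarith

end Summit.Parity.GeneralizedHardyLittlewood.Theorems.MomentsBeyondDiagonal.DiagLines

end
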